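/-
Copyright: statement-level skeleton of a published paper (lit-balaban cell, Phase-2 proof seat p39 gen 31; v1.1 doc-only gen 32). No proof claims
beyond what the kernel checks below.
-/
import Mathlib.Algebra.MvPolynomial.Derivation
import Mathlib.Topology.Algebra.MvPolynomial
import Literature.MathematicalPhysics.QuantumFieldTheory.Balaban1983to89.B3Eq122ChargeWick
import Literature.MathematicalPhysics.QuantumFieldTheory.Balaban1983to89.B3VertexTensorBounds
import Literature.MathematicalPhysics.QuantumFieldTheory.Balaban1983to89.B3Eq123RenormalizationConditions

/-!
# Bałaban, *(Higgs)₂,₃ quantum fields in a finite volume. III*, CMP 88 (1983) [Balaban1983Higgs3], pp. 416–417: THE CHARGE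
# DERIVATIVES OF ALL ORDERS of the measure (1.19)/(1.20) — `∂ᵏ/∂eᵏ e^{−½⟨φ,(−Δ^η_{eA}+m²)φ⟩} = D_k(e;A,φ)·e^{−½⟨…⟩}` with the
# insertions `D_k` = the Faà di Bruno polynomials in the hopping derivatives `h_i = Σ_bη^dc²(ηA_b)ⁱ⟪φ(b₋),qⁱU(ηeA_b)φ(b₊)⟫`,
# and `∂ᵏ/∂eᵏ ∫dA dφ e^{−S_e}F = ∫dA dφ D_k e^{−S_e}F` (dominated differentiation, every `k`, every `e`) — the layer of
# the perturbation expansions (1.21)–(1.24) in the charge that BRICK 7 `B3Eq122ChargeWick` did to order two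

statement-level skeleton of published theorems with citation tags; proofs where landed; nothing here is a claim about the
Yang–Mills mass gap.

[cite: Balaban1983Higgs3, (1.19)–(1.22) p.416 (PDF 6); (1.23)–(1.24) p.417 (PDF 7); (1.6)–(1.11) p.413 (PDF 3)]
[cite: Balaban1982Higgs1, (1.7) p.605 (`U(A) = exp(qεeA)`)] [cite: GlimmJaffeQP1987, §8.5 (perturbation series), (9.1.3)].
Unit `lit-balaban-p39-g31` (Phase-2 proof seat p39, gen 31), free-target protocol G.5-34(d), ZERO head weight: OPTIONAL located
member of rows **B3.Eq1.19-1.22** / **B3.Eq1.24** of `HOME/lit-balaban-r15/ROWS-B3.md` (owner r15; heads `proved`, decls of record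
not restated); TAKING `HOME/STATUS.md` 2026-08-24T18:51:19Z (BRICK 20 of this seat's series).  PURPOSE: the row owner's stated
preference (r15 g20, 2026-08-24T18:22:10Z) for the (1.24) window is the OPEN indices `(4,0)`, `(4,1)`, `(6,0)` of print's range
`2 ≦ α+2β ≦ 6` in structural/cumulant form; each needs at least four charge derivatives of `Z^{ct}(e,λ) = ∫dA dφ e^{−S^ε}` — BRICK 7
has the insertions `D₁`, `D₂` and the dominated differentiation under `∫dA dφ` to order two only.  This file is the generic layer:
ALL orders at once (successor option (F) of `lit-balaban-p39/DESIGN-weight6-next.md`, layers 1–2 of 5; the mass-curve dependence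
`m² + δm²(e,0)`, the vector-Gaussian moments to order six and the cumulant assembly of `(4,0)`/`(4,1)`/`(6,0)` are NOT here).
IMPORTED: BRICK 7 `B3Eq122ChargeWick` (this seat, gen 24: the charge as a variable `Ce C e`, `U(ηeA_b) = exp(ηeA_b·q)`,
`hasDerivAt_inner_Q_U`, `quadForm_eq`, `hasDerivAt_weight`, `D1`, `D2`, the joint weight `J`, `WA`, `toVec`, `weight_Ce_le`,
`WA_pos`), BRICK 10 `B3Eq123RenormalizationConditions.weight_mass_add` (the mass shift factors off the weight), the typer's
`B3VertexTensorBounds.norm_q_pow_le_one` (`‖qᵏ‖ ≤ 1`), Mathlib's `MvPolynomial.mkDerivation` (`Mathlib.Algebra.MvPolynomial.Derivation`) and `MvPolynomial.continuous_eval`.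
Nothing of record is redeclared; BRICK 7's private continuity lemma for `U` and `∣A_b∣ ≤ sup∣A∣` are re-proved privately.

PDF held: `paper:balaban1983-higgs-2-3-quantum-fields-finite-volume` (journal page = PDF page + 410); pp. 413, 416–418 read for
BRICKS 1/7/12–19 on the ×2 renders `run/shared/lean/pub/pub-balaban/b2b-balaban-ref1/pages/1983-cmp88-higgs23-III/
1983-cmp88-higgs23-III-p003-x2.png`, `…-p006-x2.png`, `…-p007-x2.png` (no new quotation is introduced here; the sentences this
file serves are (1.24) p. 417 *"E₁ = Σ_{1≤α+β≤n̄}(1/(α!β!))e^αλ^β(∂^{α+β}/∂e^α∂λ^β log∫dA∫dφ e^{−S^ε(A,φ)})∣_{e=λ=0}"* and p. 416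
(1.21) *"The function G^ε has a perturbative expansion … "*, as quoted in BRICKS 7/13/17).

THE MATHEMATICS (ours; Glimm–Jaffe §8.5 / (9.1.3) is the textbook frame: derivatives of `∫e^{−S(s)}F` in a parameter are
expectations of insertions).  By BRICK 7 `quadForm_eq` the charge enters the action (1.20) only through the hopping sum
`h₀(e;A,φ) = Σ_bη^dc²⟪φ(b₋),U(ηeA_b)φ(b₊)⟫` (`−½⟨φ,(−Δ^η_{eA}+m²)φ⟩ = −½K₀(φ) + h₀`), and `d/de U(ηea) = ηa·qU(ηea)` gives
`dh_i/de = h_{i+1}` with **`h_i = Σ_bη^dc²(ηA_b)ⁱ⟪φ(b₋),qⁱU(ηeA_b)φ(b₊)⟫`** (§1 `hopK`, `hasDerivAt_hopK`; `h₁ = D₁`).  Hence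
`∂ᵏ_e e^{h₀} = D_k·e^{h₀}` where `D_k ∈ ℝ[h₁, h₂, …]` are the Faà di Bruno (complete Bell) polynomials: `D₀ = 1`, `D_{k+1} = δD_k +
D_k·h₁` with `δ` the derivation `δh_i = h_{i+1}` of the polynomial ring (§2: `delta` = `MvPolynomial.mkDerivation ℝ (i ↦ X (i+1))` on
`MvPolynomial ℕ ℝ`, `Dpoly`, `Dk` = evaluation at the `h_i(e;A,φ)`; the chain rule through the symbols is ONE induction over
polynomials, stated ABSTRACTLY for any family of real functions with `f_i′ = f_{i+1}` and any `W` with `W′ = f₁W` —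
`hasDerivAt_eval_family`, `hasDerivAt_Dpoly_mul_family`, **`iteratedDeriv_eq_Dpoly_family`: `W⁽ᵏ⁾ = D_k(f)·W`** — so that the
successor's counterterm mass curve enters by taking `f_i = h_i − ½(δm²)⁽ⁱ⁾(e)·Σ_xη^d∣φ(x)∣²` with nothing here re-proved); §3 **`iteratedDeriv_weight`: `∂ᵏ_e e^{−½⟨φ,(−Δ^η_{eA}+m²)φ⟩} = D_k(e;A,φ)·e^{−½⟨…⟩}` for every `k`**;
§4 `D₁ = h₁`, `D₂ = h₂ + h₁²` (= BRICK 7's `D1`, `D2`: `Dk_one`, `Dk_two`), **`D₃ = h₃ + 3h₁h₂ + h₁³`, `D₄ = h₄ + 4h₁h₃ + 3h₂² +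
6h₁²h₂ + h₁⁴`** (`Dk_three`, `Dk_four`).  §5 ALONG A MASS CURVE `m² + ct(e)` (print's counterterm series of (1.23) inserted, as in
BRICKS 10/14/16/17): with `f_i = h_i − ½ct_i(e)·Σ_xη^d∣φ(x)∣²` for any family `ct_i′ = ct_{i+1}` (`MassCurve.fM`, `MassCurve.DkM`),
**`MassCurve.iteratedDeriv_weight_massCurve`: `∂ᵏ_e e^{−½⟨φ,(−Δ^η_{eA}+m²+ct(e))φ⟩} = D^M_k·e^{−½⟨…⟩}` for every `k`** (BRICK 10 §2 =
`k = 1, 2`), pointwise; and §8, under `∫dA dφ` on an open set `S` of charges with `m² + ct ≥ m²/2`, `∣ct_i∣ ≤ B_c`: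
**`MassCurve.hasDerivAt_integral_DkM_J_mul`**, **`MassCurve.iteratedDeriv_integral_J_massCurve`: `∂ᵏ_e∫dA dφ e^{−S_e(m²+ct(e))}F =
∫dA dφ D^M_k·e^{−S_e(m²+ct(e))}F` on `S`, every `k`** (BRICKS 14/16/17 = orders ≤ 2 on the ball `∣δm²_{(2,0)}e²+δm²_{(4,0)}e⁴∣ ≤ m²/2`).  §6: `∣h_i∣ ≤ K_i·aⁱ·sup∣φ∣²` for `∣A_b∣ ≤ a` uniformly in `e` (`‖qⁱ‖ ≤ 1`, `U` unitary),
hence EVERY polynomial in the `h_i` — in particular every `D_k` — is `≤ K·e^{κ₁a}·e^{κ₂sup∣φ∣}` uniformly in `e` (`eval_bound`, one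
induction; `abs_Dk_le`), and `D_k` is continuous in `(A,φ)` (`continuous_Dk`).  §7: with the product majorant
`[W_A(A)e^{κ₁sup∣A∣}]·[e^{(κ₂+κ)sup∣φ∣}e^{−(m²η^d/2)Σ∣φ∣²}]` (`integrable_majorant'`, BRICK 7's with a free `A`-rate) Mathlib's
`hasDerivAt_integral_of_dominated_loc_of_deriv_le` gives **`hasDerivAt_integral_Dk_J_mul`: `d/de∫D_k(e)e^{−S_e}F = ∫D_{k+1}(e)e^{−S_e}F`
at every `e₀`, every `k`**, for every observable `F(φ)` of exponential-linear growth; so **`iteratedDeriv_integral_J_mul`: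
`∂ᵏ_e∫dA dφ e^{−S_e}F = ∫dA dφ D_k(e)e^{−S_e}F`**, **`contDiff_integral_J_mul`: `e ↦ ∫e^{−S_e}F` is `Cⁿ` for every `n`**, and
`iteratedDeriv_Z` (`F = 1`).

WHAT IS AND IS NOT DERIVED HERE; THE DOMINATING BOUND (owner r15's ask, 2026-08-24T18:51:38Z).  NO index `(α,β)` of (1.23) or
(1.24) is derived in this file: it is infrastructure — the insertions `D_k` and the differentiation under `∫dA dφ` to all orders
for the measure at `λ = 0`, at a fixed mass `m²` (§3, §7) and ALONG ANY MASS CURVE `m² + ct(e)` (§5 pointwise, §8 under the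
integral on an open set of charges where `m² + ct(e) ≥ m²/2` and the `ct⁽ⁱ⁾` are bounded — the majorant at mass `m²/2`, BRICK
16/17's device; layers 1–3 of option (F)); the `A`-Gaussian moments of `D_k(0;A,φ)` to order six (layer 4) and the cumulant assembly of `∂⁴_e log Z^{ct}`, `∂_λ⁺∂⁴_e`,
`∂⁶_e` at `0` (layer 5) are the successor's.  THE BOUND the successor inherits (§6, uniform in the charge `e`, for `∣A_b∣ ≤ a`,
`a ≥ 0`): termwise POLYNOMIAL, `∣h_k(e;A,φ)∣ ≤ K_k·aᵏ·sup_x∣φ(x)∣²` with `K_k = Σ_bη^dc²∣η∣ᵏ` (`abs_hopK_le`); for the polynomials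
`D_k` it is packaged COARSELY as exponential-linear, `∣D_k(e;A,φ)∣ ≤ K·e^{κ₁a}·e^{κ₂sup∣φ∣}` with SOME constants `K, κ₁, κ₂ ≥ 0`
depending on `k` and the lattice data only (`abs_Dk_le`, existential — `aⁱ ≤ e^{ia}`, `sup∣φ∣² ≤ e^{2sup∣φ∣}` are used inside),
which is what the dominated-convergence majorant `[W_A(A)e^{κ₁sup∣A∣}]·[e^{(κ₂+κ_F)sup∣φ∣}e^{−(m²η^d/2)Σ_x∣φ(x)∣²}]`
(`integrable_majorant'`) needs: any observable `F(φ)` with `∣F∣ ≤ K_Fe^{κ_Fsup∣φ∣}` (`ExpGrowth`) is admissible, at every `e`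
(no smallness of `e`), for every `k`.  Along a mass curve (§8) the same holds for `e` in an open set `S` with `∣ct_i(e)∣ ≤ B_c`
(all `i`) and `m² + ct(e) ≥ m²/2` on `S` (`MassCurve.abs_fM_le`: `∣f_i∣ ≤ (K_iaⁱ + ½∣B_c∣∣T∣η^d)sup∣φ∣²`; `MassCurve.abs_DkM_le`);
the majorant is then taken at mass `m²/2` (`MassCurve.weight_massCurve_le`).  A successor wanting polynomial moment bounds (e.g. uniformity of constants in `N`) should
use `abs_hopK_le` termwise rather than `abs_Dk_le`.

THE SETTING = BRICK 7's: the model torus `T^{(j)}_η` (`B3WT223Instance`; print's `T_ε`, `η = ε`, `w = η^d`, `c = η⁻¹`), scalar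
fields `φ : T → ℝ^N`, vector fields `A` with bond values `A_b` (`VecField`; on the product space `JCfg = (A,φ)` via `toVec`), the
charge data `C` (antisymmetric `q`, `‖q‖ ≤ 1`) turned into a variable charge `Ce C e`, the scalar weight `weight (Ce C e) η w c m2 A φ
= e^{−½⟨φ,(−Δ^η_{eA}+m²)φ⟩}`, the joint weight `J C η w c m2 μ2 e (A,φ) = W_A(A)·weight` (Feynman gauge, vector mass `μ2`).
Hypotheses for §6: `η^d > 0`, `m² > 0`, `μ² > 0`; §1–§5 pointwise, no hypothesis; any level, mesh, dimension, `N`.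

v1.1 (gen 32; DOC-ONLY — every declaration byte-identical to v1.0 p384855 ✓ e2927faea1b0; referee ref-4's locator ask D-g100-1,
2026-08-24T19:50:12Z; p. 430 re-read AS AN IMAGE for this version on `…/1983-cmp88-higgs23-III-p020-x2.png`, 2026-08-24T21:10Z): the four docstrings of §6/§8 that tagged the exponential-linear
growth class with «(2.24) p.430 (the admissible F)» now say what print says there — (2.23)–(2.24) are the Ward–Takahashi identities,
*"F(φ) is an arbitrary gauge-invariant function of scalar fields"*, taken polynomial (*"F(φ) = −λ_k:∣φ(x)∣⁴:, or F(φ) = −½δm₁²(x):∣φ(x)∣²:,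
or …"*) — and that the class `∣F∣ ≤ K_Fe^{κ_F sup∣φ∣}` (`ExpGrowth`) is OURS (the admissibility class of the dominated differentiation),
consistent with «THE MATHEMATICS (ours)» above.

WHAT THIS FILE PROVES — definitions WITH BODIES: `hopK` (the `h_i`), `delta` (the derivation), `Dpoly` (the Faà di Bruno
polynomials), `Dk` (the insertions), `MassCurve.fM` / `MassCurve.DkM` (the same along a mass curve), `Kk` (the constants `Σ_bη^dc²∣η∣ᵏ`);
layers 1–3 of option (F): what remains for `(4,0)`/`(4,1)`/`(6,0)` is the `A`-integration at `e = 0` and the cumulant bookkeeping; theorems as listed above; no named fact, no `sorry`,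
standard axioms.

HONEST SCOPE.  (a) Generic calculus of the measure (1.19)/(1.20) at `λ = 0` in the charge, at fixed mass and along a mass curve (for print's
`ct(e) = δm²_{(2,0)}e² + δm²_{(4,0)}e⁴` the consumer supplies `ct_i = ct⁽ⁱ⁾`, `S` = a ball at `0`, `B_c`); the quotient `log`/normalization, the `A`-integration of `D_k(0;A,φ)`
(vector-Gaussian moments of order `k`) and any graph are NOT treated — successor layers 3–5 of option (F).  (b) `D_k` is given
as a recursion / a polynomial identity, explicitly only for `k ≤ 4`; the closed Faà di Bruno formula is not stated.  (c) The bounds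
are qualitative (existential constants, uniform in `e`): enough for dominated differentiation, no uniformity in `ε`, `N` or the
volume is claimed.  (d) The identification of `∫dA dφ e^{−S_e}` with (1.19)'s measure in the Feynman gauge is BRICK 7's
(`J_eq_exp_neg_feynmanHiggsAction`), said there.

References: [Balaban1983Higgs3] T. Bałaban, *(Higgs)₂,₃ quantum fields in a finite volume. III. Renormalization*, CMP 88 (1983)
411–445, (1.19)–(1.24) pp. 416–417, (1.6)–(1.11) p. 413; [Balaban1982Higgs1] T. Bałaban, *(Higgs)₂,₃ quantum fields in a finite
volume. I*, CMP 85 (1982) 603–636, (1.7) p. 605; [GlimmJaffeQP1987] J. Glimm, A. Jaffe, *Quantum Physics. A Functional Integral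
Point of View*, 2nd ed. (Springer 1987), §8.5, §9.1 (9.1.3).
-/

noncomputable section

open scoped BigOperators InnerProductSpace

namespace Literature.MathematicalPhysics.QuantumFieldTheory.Balaban1983to89.B3ChargeInsertionsHigher

open _root_.MeasureTheory
open LatticeFieldCalculus B3WT223Instance B3WTPropagator B3WTCovariance B3WickVertexCalculus B3Eq122ChargeWick MvPolynomial

variable {P : Params} {j N : ℕ} (C : HiggsLattice.ChargeData N) (η w c m2 μ2 : ℝ)

/-! ## §1 The hopping sum and its `e`-derivatives of all orders -/

/-- `h_k(e; A, φ) = Σ_b η^dc²·(ηA_b)ᵏ·⟪φ(b₋), qᵏU(ηeA_b)φ(b₊)⟫` — the `k`-th `e`-derivative of the hopping sum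
`h₀ = Σ_bη^dc²⟪φ(b₋),U(ηeA_b)φ(b₊)⟫` of the action (1.20) (`−½⟨φ,(−Δ^η_A+m²)φ⟩ = −½K₀ + h₀`, BRICK 7 `quadForm_eq`); `h₁ = D₁`.
[cite: Balaban1983Higgs3, (1.20) p.416; (1.8), (1.10) p.413] -/
def hopK (k : ℕ) (e : ℝ) (A : VecField P j ℝ) (φ : Cfg P j N) : ℝ :=
  ∑ b : PBond P j, w * (c ^ 2 * ((η * A b) ^ k * ⟪φ b.src, (C.q ^ k) ((Ce C e).U η (A b) (φ b.tgt))⟫_ℝ))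

/-- `d/de h_k = h_{k+1}`. [cite: Balaban1982Higgs1, (1.7) p.605] -/
theorem hasDerivAt_hopK (k : ℕ) (A : VecField P j ℝ) (φ : Cfg P j N) (e : ℝ) :
    HasDerivAt (fun s : ℝ => hopK C η w c k s A φ) (hopK C η w c (k + 1) e A φ) e := by
  unfold hopK
  refine HasDerivAt.fun_sum fun b _ => ?_
  have h := (((hasDerivAt_inner_Q_U C η (C.q ^ k) (A b) (φ b.src) (φ b.tgt) e).const_mul ((η * A b) ^ k)).const_mul
    (c ^ 2)).const_mul w
  refine h.congr_deriv ?_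
  rw [pow_succ (η * A b) k, pow_succ (C.q) k]
  simp only [ContinuousLinearMap.mul_def, ContinuousLinearMap.coe_comp, Function.comp_apply]
  ring

/-- `h₁ = D₁` (BRICK 7's first insertion). [cite: Balaban1983Higgs3, (1.8) p.413] -/
theorem hopK_one (e : ℝ) (A : VecField P j ℝ) (φ : Cfg P j N) : hopK C η w c 1 e A φ = D1 C η w c e A φ := by
  unfold hopK D1
  simp only [pow_one]

/-- `h₂ = Σ_bη^dc²(ηA_b)²⟪φ(b₋),q²Uφ(b₊)⟫` (the first summand of BRICK 7's `D₂`). [cite: Balaban1983Higgs3, (1.10) p.413] -/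
theorem hopK_two (e : ℝ) (A : VecField P j ℝ) (φ : Cfg P j N) : hopK C η w c 2 e A φ =
    ∑ b : PBond P j, w * (c ^ 2 * ((η * A b) ^ 2 * ⟪φ b.src, C.q (C.q ((Ce C e).U η (A b) (φ b.tgt)))⟫_ℝ)) := by
  unfold hopK
  simp only [sq, ContinuousLinearMap.mul_def, ContinuousLinearMap.coe_comp, Function.comp_apply]

/-- `d/de h₀ … `: the weight itself, `d/de e^{−½⟨φ,(−Δ^η_{eA}+m²)φ⟩} = h₁·e^{−½⟨…⟩}` (BRICK 7 `hasDerivAt_weight`, restated with `h₁`).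
[cite: Balaban1983Higgs3, (1.20) p.416] -/
theorem hasDerivAt_weight' (A : VecField P j ℝ) (φ : Cfg P j N) (e : ℝ) :
    HasDerivAt (fun s : ℝ => weight (Ce C s) η w c m2 A φ) (hopK C η w c 1 e A φ * weight (Ce C e) η w c m2 A φ) e := by
  rw [hopK_one]
  exact hasDerivAt_weight C η w c m2 A φ e

/-! ## §2 Faà di Bruno bookkeeping: the derivation `δh_i = h_{i+1}` on `ℝ[h₀, h₁, …]` and the polynomials `D_k` -/

/-- the derivation `δ` of the polynomial ring `ℝ[h₀, h₁, h₂, …]` (`MvPolynomial ℕ ℝ`) with `δh_i = h_{i+1}` — differentiation in `e`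
at the level of symbols. [cite: GlimmJaffeQP1987, (9.1.3)] -/
def delta : Derivation ℝ (MvPolynomial ℕ ℝ) (MvPolynomial ℕ ℝ) :=
  MvPolynomial.mkDerivation ℝ (fun i : ℕ => (X (i + 1) : MvPolynomial ℕ ℝ))

/-- `δh_i = h_{i+1}`. [cite: GlimmJaffeQP1987, (9.1.3)] -/
@[simp]
theorem delta_X (i : ℕ) : delta (X i) = X (i + 1) :=
  MvPolynomial.mkDerivation_X _ _ _

/-- the Faà di Bruno polynomials of `e^{h}`: `D₀ = 1`, `D_{k+1} = δD_k + D_k·h₁` (so `∂ᵏ_e e^{h(e)} = D_k(h′, h″, …)e^{h}`).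
[cite: GlimmJaffeQP1987, (9.1.3)] -/
def Dpoly : ℕ → MvPolynomial ℕ ℝ
  | 0 => 1
  | k + 1 => delta (Dpoly k) + Dpoly k * X 1

/-- `D₀ = 1`. [cite: GlimmJaffeQP1987, (9.1.3)] -/
@[simp] theorem Dpoly_zero : Dpoly 0 = 1 := rfl

/-- `D_{k+1} = δD_k + D_k·h₁`. [cite: GlimmJaffeQP1987, (9.1.3)] -/
theorem Dpoly_succ (k : ℕ) : Dpoly (k + 1) = delta (Dpoly k) + Dpoly k * X 1 := rfl

/-- THE `k`-TH CHARGE INSERTION `D_k(e; A, φ) = D_k(h₁, h₂, …)(e; A, φ)`. [cite: Balaban1983Higgs3, (1.20) p.416] -/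
def Dk (k : ℕ) (e : ℝ) (A : VecField P j ℝ) (φ : Cfg P j N) : ℝ :=
  MvPolynomial.eval (fun i : ℕ => hopK C η w c i e A φ) (Dpoly k)

/-- **the chain rule through the symbols** (abstract): for ANY family of real functions with `f_i′ = f_{i+1}`,
`d/de P(f₀(e), f₁(e), …) = (δP)(f₀(e), f₁(e), …)` for every polynomial `P` — one induction over polynomials.
[cite: GlimmJaffeQP1987, (9.1.3)] -/
theorem hasDerivAt_eval_family {f : ℕ → ℝ → ℝ} (hf : ∀ (i : ℕ) (e : ℝ), HasDerivAt (f i) (f (i + 1) e) e)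
    (p : MvPolynomial ℕ ℝ) (e : ℝ) :
    HasDerivAt (fun s : ℝ => MvPolynomial.eval (fun i : ℕ => f i s) p)
      (MvPolynomial.eval (fun i : ℕ => f i e) (delta p)) e := by
  induction p using MvPolynomial.induction_on with
  | C a =>
    simp only [eval_C, MvPolynomial.derivation_C, map_zero]
    exact hasDerivAt_const e a
  | add p q hp hq =>
    simp only [map_add]
    exact hp.add hq
  | mul_X p i hp =>
    simp only [map_mul, eval_X, Derivation.leibniz, delta_X, smul_eq_mul, map_add]
    exact (hp.mul (hf i e)).congr_deriv (by ring)

/-- **Faà di Bruno, abstract**: if `f_i′ = f_{i+1}` and `W′ = f₁·W` (e.g. `W = e^{f₀}`), then `(D_k(f)·W)′ = D_{k+1}(f)·W`.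
[cite: GlimmJaffeQP1987, (9.1.3)] -/
theorem hasDerivAt_Dpoly_mul_family {f : ℕ → ℝ → ℝ} (hf : ∀ (i : ℕ) (e : ℝ), HasDerivAt (f i) (f (i + 1) e) e)
    {W : ℝ → ℝ} (hW : ∀ e : ℝ, HasDerivAt W (f 1 e * W e) e) (k : ℕ) (e : ℝ) :
    HasDerivAt (fun s : ℝ => MvPolynomial.eval (fun i : ℕ => f i s) (Dpoly k) * W s)
      (MvPolynomial.eval (fun i : ℕ => f i e) (Dpoly (k + 1)) * W e) e := by
  have h := (hasDerivAt_eval_family hf (Dpoly k) e).mul (hW e)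
  refine h.congr_deriv ?_
  simp only [Dpoly_succ, map_add, map_mul, eval_X]
  ring

/-- hence **`W⁽ᵏ⁾ = D_k(f)·W`** for every `k` (abstract form of `∂ᵏe^{f₀} = D_k(f′,f″,…)e^{f₀}`). [cite: GlimmJaffeQP1987, (9.1.3)] -/
theorem iteratedDeriv_eq_Dpoly_family {f : ℕ → ℝ → ℝ} (hf : ∀ (i : ℕ) (e : ℝ), HasDerivAt (f i) (f (i + 1) e) e)
    {W : ℝ → ℝ} (hW : ∀ e : ℝ, HasDerivAt W (f 1 e * W e) e) (k : ℕ) (e : ℝ) :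
    iteratedDeriv k W e = MvPolynomial.eval (fun i : ℕ => f i e) (Dpoly k) * W e := by
  induction k generalizing e with
  | zero => simp
  | succ k ih =>
    rw [iteratedDeriv_succ, show iteratedDeriv k W = fun s => MvPolynomial.eval (fun i : ℕ => f i s) (Dpoly k) * W s
      from funext ih]
    exact (hasDerivAt_Dpoly_mul_family hf hW k e).deriv

/-- the chain rule through the symbols for the hopping derivatives `h_i(e; A, φ)`. [cite: GlimmJaffeQP1987, (9.1.3)] -/
theorem hasDerivAt_eval (p : MvPolynomial ℕ ℝ) (A : VecField P j ℝ) (φ : Cfg P j N) (e : ℝ) :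
    HasDerivAt (fun s : ℝ => MvPolynomial.eval (fun i : ℕ => hopK C η w c i s A φ) p)
      (MvPolynomial.eval (fun i : ℕ => hopK C η w c i e A φ) (delta p)) e :=
  hasDerivAt_eval_family (fun i e => hasDerivAt_hopK C η w c i A φ e) p e

/-! ## §3 `∂ᵏ_e e^{−½⟨φ,(−Δ^η_{eA}+m²)φ⟩} = D_k·e^{−½⟨…⟩}` for every `k` -/

/-- `D₀ = 1`. [cite: Balaban1983Higgs3, (1.20) p.416] -/
theorem Dk_zero (e : ℝ) (A : VecField P j ℝ) (φ : Cfg P j N) : Dk C η w c 0 e A φ = 1 := by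
  simp [Dk]

/-- `D_{k+1} = (δD_k)(h) + D_k·h₁`. [cite: Balaban1983Higgs3, (1.20) p.416] -/
theorem Dk_succ (k : ℕ) (e : ℝ) (A : VecField P j ℝ) (φ : Cfg P j N) : Dk C η w c (k + 1) e A φ =
    MvPolynomial.eval (fun i : ℕ => hopK C η w c i e A φ) (delta (Dpoly k)) + Dk C η w c k e A φ * hopK C η w c 1 e A φ := by
  simp only [Dk, Dpoly_succ, map_add, map_mul, eval_X]

/-- **`d/de (D_k·W) = D_{k+1}·W`** (`W = e^{−½⟨φ,(−Δ^η_{eA}+m²)φ⟩}`): the recursion of the charge insertions, for every `k`.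
[cite: Balaban1983Higgs3, (1.20) p.416] [cite: GlimmJaffeQP1987, (9.1.3)] -/
theorem hasDerivAt_Dk_mul_weight (k : ℕ) (A : VecField P j ℝ) (φ : Cfg P j N) (e : ℝ) :
    HasDerivAt (fun s : ℝ => Dk C η w c k s A φ * weight (Ce C s) η w c m2 A φ)
      (Dk C η w c (k + 1) e A φ * weight (Ce C e) η w c m2 A φ) e :=
  hasDerivAt_Dpoly_mul_family (fun i e => hasDerivAt_hopK C η w c i A φ e) (hasDerivAt_weight' C η w c m2 A φ) k e

/-- **THE CHARGE DERIVATIVES OF THE BOLTZMANN WEIGHT TO ALL ORDERS**: `∂ᵏ/∂eᵏ e^{−½⟨φ,(−Δ^η_{eA}+m²)φ⟩} = D_k(e;A,φ)·e^{−½⟨…⟩}`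
for every `k`, at every charge `e` and every `(A, φ)`. [cite: Balaban1983Higgs3, (1.20) p.416, (1.24) p.417]
[cite: GlimmJaffeQP1987, §8.5] -/
theorem iteratedDeriv_weight (k : ℕ) (A : VecField P j ℝ) (φ : Cfg P j N) (e : ℝ) :
    iteratedDeriv k (fun s : ℝ => weight (Ce C s) η w c m2 A φ) e = Dk C η w c k e A φ * weight (Ce C e) η w c m2 A φ :=
  iteratedDeriv_eq_Dpoly_family (fun i e => hasDerivAt_hopK C η w c i A φ e) (hasDerivAt_weight' C η w c m2 A φ) k e

/-! ## §4 The first insertions explicitly: `D₁ = h₁`, `D₂ = h₂ + h₁²` (BRICK 7's), `D₃ = h₃ + 3h₁h₂ + h₁³`,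
`D₄ = h₄ + 4h₁h₃ + 3h₂² + 6h₁²h₂ + h₁⁴` -/

/-- `D₁ = h₁ = BRICK 7's D₁`. [cite: Balaban1983Higgs3, (1.8) p.413] -/
theorem Dk_one (e : ℝ) (A : VecField P j ℝ) (φ : Cfg P j N) : Dk C η w c 1 e A φ = D1 C η w c e A φ := by
  rw [← hopK_one C η w c]
  simp [Dk, Dpoly_succ]

/-- `D₂ = h₂ + h₁² = BRICK 7's D₂`. [cite: Balaban1983Higgs3, (1.10) p.413] -/
theorem Dk_two (e : ℝ) (A : VecField P j ℝ) (φ : Cfg P j N) : Dk C η w c 2 e A φ = D2 C η w c e A φ := by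
  unfold D2
  rw [← hopK_one C η w c, ← hopK_two C η w c]
  simp [Dk, Dpoly_succ]
  ring

/-- `D₃ = h₃ + 3h₁h₂ + h₁³`. [cite: GlimmJaffeQP1987, (9.1.3)] -/
theorem Dk_three (e : ℝ) (A : VecField P j ℝ) (φ : Cfg P j N) : Dk C η w c 3 e A φ =
    hopK C η w c 3 e A φ + 3 * (hopK C η w c 1 e A φ * hopK C η w c 2 e A φ) + hopK C η w c 1 e A φ ^ 3 := by
  simp [Dk, Dpoly_succ, Derivation.leibniz]
  ring

/-- `D₄ = h₄ + 4h₁h₃ + 3h₂² + 6h₁²h₂ + h₁⁴`. [cite: GlimmJaffeQP1987, (9.1.3)] -/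
theorem Dk_four (e : ℝ) (A : VecField P j ℝ) (φ : Cfg P j N) : Dk C η w c 4 e A φ =
    hopK C η w c 4 e A φ + 4 * (hopK C η w c 1 e A φ * hopK C η w c 3 e A φ) + 3 * hopK C η w c 2 e A φ ^ 2
      + 6 * (hopK C η w c 1 e A φ ^ 2 * hopK C η w c 2 e A φ) + hopK C η w c 1 e A φ ^ 4 := by
  simp [Dk, Dpoly_succ, Derivation.leibniz]
  ring

/-! ## §5 ALONG A MASS CURVE `m² + ct(e)` (the counterterm of (1.23) inserted): the insertions `D^M_k = D_k(f)` with
`f_i = h_i − ½ct⁽ⁱ⁾(e)·Σ_xη^d∣φ(x)∣²` — pointwise, every order (BRICK 10 `B3Eq123RenormalizationConditions` §2 = orders 1, 2) -/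

namespace MassCurve

variable (cts : ℕ → ℝ → ℝ)

/-- the symbols along the curve: `f_i(e; A, φ) = h_i(e; A, φ) − ½·ct_i(e)·Σ_xη^d∣φ(x)∣²` (`ct_i` = the `i`-th derivative of the
counterterm curve). [cite: Balaban1983Higgs3, (1.20) p.416, (1.23) p.417] -/
def fM (i : ℕ) (e : ℝ) (A : VecField P j ℝ) (φ : Cfg P j N) : ℝ :=
  hopK C η w c i e A φ - 1 / 2 * cts i e * massForm w φ

/-- the insertions along the curve: `D^M_k = D_k(f₁, f₂, …)`. [cite: Balaban1983Higgs3, (1.20) p.416, (1.23) p.417] -/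
def DkM (k : ℕ) (e : ℝ) (A : VecField P j ℝ) (φ : Cfg P j N) : ℝ :=
  MvPolynomial.eval (fun i : ℕ => fM C η w c cts i e A φ) (Dpoly k)

variable {cts}

/-- `f_i′ = f_{i+1}` when `ct_i′ = ct_{i+1}`. [cite: Balaban1983Higgs3, (1.20) p.416] -/
theorem hasDerivAt_fM (hct : ∀ (i : ℕ) (e : ℝ), HasDerivAt (cts i) (cts (i + 1) e) e) (i : ℕ) (A : VecField P j ℝ)
    (φ : Cfg P j N) (e : ℝ) :
    HasDerivAt (fun s : ℝ => fM C η w c cts i s A φ) (fM C η w c cts (i + 1) e A φ) e := by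
  unfold fM
  exact (hasDerivAt_hopK C η w c i A φ e).sub (((hct i e).const_mul (1 / 2 : ℝ)).mul_const (massForm w φ))

/-- the weight along the curve and its first derivative: `d/de e^{−½⟨φ,(−Δ^η_{eA}+m²+ct(e))φ⟩} = f₁·e^{−½⟨…⟩}`.
[cite: Balaban1983Higgs3, (1.20) p.416, (1.23) p.417] -/
theorem hasDerivAt_weight_massCurve (hct : ∀ (i : ℕ) (e : ℝ), HasDerivAt (cts i) (cts (i + 1) e) e) (A : VecField P j ℝ)
    (φ : Cfg P j N) (e : ℝ) :
    HasDerivAt (fun s : ℝ => weight (Ce C s) η w c (m2 + cts 0 s) A φ)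
      (fM C η w c cts 1 e A φ * weight (Ce C e) η w c (m2 + cts 0 e) A φ) e := by
  have hfun : (fun s : ℝ => weight (Ce C s) η w c (m2 + cts 0 s) A φ) =
      fun s => weight (Ce C s) η w c m2 A φ * Real.exp (-(1 / 2 : ℝ) * cts 0 s * massForm w φ) := by
    funext s; rw [B3Eq123RenormalizationConditions.weight_mass_add]
  rw [hfun]
  have hW := hasDerivAt_weight' C η w c m2 A φ e
  have hE : HasDerivAt (fun s : ℝ => Real.exp (-(1 / 2 : ℝ) * cts 0 s * massForm w φ))
      (Real.exp (-(1 / 2 : ℝ) * cts 0 e * massForm w φ) * (-(1 / 2 : ℝ) * cts 1 e * massForm w φ)) e :=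
    (((hct 0 e).const_mul (-(1 / 2 : ℝ))).mul_const (massForm w φ)).exp
  refine (hW.mul hE).congr_deriv ?_
  rw [B3Eq123RenormalizationConditions.weight_mass_add]
  unfold fM
  ring

/-- **`∂ᵏ/∂eᵏ e^{−½⟨φ,(−Δ^η_{eA}+m²+ct(e))φ⟩} = D^M_k(e;A,φ)·e^{−½⟨…⟩}` for every `k`** — BRICK 20's abstract Faà di Bruno with
`f_i = h_i − ½ct⁽ⁱ⁾Σ∣φ∣²` (BRICK 10 §2 = the cases `k = 1, 2`). [cite: Balaban1983Higgs3, (1.20) p.416, (1.23)–(1.24) p.417] -/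
theorem iteratedDeriv_weight_massCurve (hct : ∀ (i : ℕ) (e : ℝ), HasDerivAt (cts i) (cts (i + 1) e) e) (k : ℕ)
    (A : VecField P j ℝ) (φ : Cfg P j N) (e : ℝ) :
    iteratedDeriv k (fun s : ℝ => weight (Ce C s) η w c (m2 + cts 0 s) A φ) e =
      DkM C η w c cts k e A φ * weight (Ce C e) η w c (m2 + cts 0 e) A φ :=
  iteratedDeriv_eq_Dpoly_family (fun i e => hasDerivAt_fM C η w c hct i A φ e)
    (hasDerivAt_weight_massCurve C η w c m2 hct A φ) k e

/-- the recursion `d/de (D^M_k·W) = D^M_{k+1}·W` along the curve. [cite: Balaban1983Higgs3, (1.20) p.416, (1.23) p.417] -/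
theorem hasDerivAt_DkM_mul_weight (hct : ∀ (i : ℕ) (e : ℝ), HasDerivAt (cts i) (cts (i + 1) e) e) (k : ℕ)
    (A : VecField P j ℝ) (φ : Cfg P j N) (e : ℝ) :
    HasDerivAt (fun s : ℝ => DkM C η w c cts k s A φ * weight (Ce C s) η w c (m2 + cts 0 s) A φ)
      (DkM C η w c cts (k + 1) e A φ * weight (Ce C e) η w c (m2 + cts 0 e) A φ) e :=
  hasDerivAt_Dpoly_mul_family (fun i e => hasDerivAt_fM C η w c hct i A φ e)
    (hasDerivAt_weight_massCurve C η w c m2 hct A φ) k e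

end MassCurve


/-! ## §6 Continuity and bounds uniform in the charge -/

/-- continuity of `(a, v) ↦ U(ηea)v` jointly (BRICK 7's private lemma, re-proved). [folklore] -/
private theorem continuous_U_apply₂ (e : ℝ) {X : Type*} [TopologicalSpace X] {f : X → ℝ} {g : X → EuclideanSpace ℝ (Fin N)}
    (hf : Continuous f) (hg : Continuous g) : Continuous fun x => (Ce C e).U η (f x) (g x) := by
  letI : NormedAlgebra ℚ (EuclideanSpace ℝ (Fin N) →L[ℝ] EuclideanSpace ℝ (Fin N)) := NormedAlgebra.restrictScalars ℚ ℝ _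
  have hU : Continuous fun x => (Ce C e).U η (f x) := by
    simp only [Ce_U]
    exact NormedSpace.exp_continuous.comp (((continuous_const.mul hf)).smul continuous_const)
  exact isBoundedBilinearMap_apply.continuous.comp (hU.prodMk hg)

omit C η w c m2 μ2 in
/-- `|A_b| ≤ sup|A|` (BRICK 7's private lemma, re-proved). [folklore] -/
private theorem abs_toVec_le (A : Cfg P j P.d) (b : PBond P j) : |toVec A b| ≤ ‖A‖ := by
  rw [toVec_apply]
  calc |⟪A b.src, EuclideanSpace.basisFun (Fin P.d) ℝ b.dir⟫_ℝ|
      ≤ ‖A b.src‖ * ‖EuclideanSpace.basisFun (Fin P.d) ℝ b.dir‖ := abs_real_inner_le_norm _ _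
    _ = ‖A b.src‖ := by rw [(EuclideanSpace.basisFun (Fin P.d) ℝ).orthonormal.1, mul_one]
    _ ≤ ‖A‖ := norm_le_pi_norm A b.src

/-- continuity of `(A, φ) ↦ h_k(e; A, φ)`. [folklore] -/
private theorem continuous_hopK (k : ℕ) (e : ℝ) : Continuous fun p : JCfg P j N => hopK C η w c k e (toVec p.1) p.2 := by
  unfold hopK
  refine continuous_finsetSum _ fun b _ => continuous_const.mul (continuous_const.mul
    (((continuous_const.mul (((continuous_apply b.src).comp continuous_fst).inner continuous_const)).pow k).mul
      (((continuous_apply b.src).comp continuous_snd).inner ((C.q ^ k).continuous.comp (continuous_U_apply₂ C η e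
        (((continuous_apply b.src).comp continuous_fst).inner continuous_const) ((continuous_apply b.tgt).comp continuous_snd))))))

/-- continuity of `(A, φ) ↦ D_k(e; A, φ)` (a polynomial in the `h_i`). [folklore] -/
private theorem continuous_Dk (k : ℕ) (e : ℝ) : Continuous fun p : JCfg P j N => Dk C η w c k e (toVec p.1) p.2 := by
  unfold Dk
  exact (MvPolynomial.continuous_eval (p := Dpoly k)).comp (continuous_pi fun i => continuous_hopK C η w c i e)

/-- continuity of the joint weight (BRICK 7's private lemma, re-derived from `D₀ = 1`-free pieces). [folklore] -/
private theorem continuous_J (e : ℝ) : Continuous fun p : JCfg P j N => J C η w c m2 μ2 e p := by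
  have h1 : Continuous fun p : JCfg P j N => WA η w c μ2 p.1 :=
    (B3WT224Instance.continuous_weight (Cvec P.d) η w c μ2 _).comp continuous_fst
  have h2 : Continuous fun p : JCfg P j N => weight (Ce C e) η w c m2 (toVec p.1) p.2 := by
    have e2 : (fun p : JCfg P j N => weight (Ce C e) η w c m2 (toVec p.1) p.2) =
        fun p => Real.exp (-(1 / 2 : ℝ) * (K0 w c m2 p.2 - 2 * hopK C η w c 0 e (toVec p.1) p.2)) := by
      funext p
      rw [weight, quadForm_eq]
      simp only [hopK, hop, pow_zero, one_mul, one_apply_eq_self]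
    rw [e2]
    refine (continuous_const.mul ((?_ : Continuous fun p : JCfg P j N => K0 w c m2 p.2).sub
      (continuous_const.mul (continuous_hopK C η w c 0 e)))).rexp
    unfold K0 massForm
    refine Continuous.add (continuous_finsetSum _ fun b _ => continuous_const.mul (continuous_const.mul
      ((((continuous_apply b.tgt).comp continuous_snd).norm.pow 2).add
        (((continuous_apply b.src).comp continuous_snd).norm.pow 2)))) (continuous_const.mul
      (continuous_finsetSum _ fun x _ => continuous_const.mul (((continuous_apply x).comp continuous_snd).norm.pow 2)))
  exact h1.mul h2

/-- `|⟪u, qᵏUv⟫| ≤ |u||v|`. [cite: Balaban1982Higgs1, (1.7) p.605] -/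
theorem abs_inner_qpowU_le (k : ℕ) (e a : ℝ) (u v : EuclideanSpace ℝ (Fin N)) :
    |⟪u, (C.q ^ k) ((Ce C e).U η a v)⟫_ℝ| ≤ ‖u‖ * ‖v‖ := by
  have h : |⟪u, (C.q ^ k) ((Ce C e).U η a v)⟫_ℝ| ≤ ‖C.q ^ k‖ * (‖u‖ * ‖(Ce C e).U η a v‖) := by
    calc |⟪u, (C.q ^ k) ((Ce C e).U η a v)⟫_ℝ| ≤ ‖u‖ * ‖(C.q ^ k) ((Ce C e).U η a v)‖ := abs_real_inner_le_norm _ _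
      _ ≤ ‖u‖ * (‖C.q ^ k‖ * ‖(Ce C e).U η a v‖) := mul_le_mul_of_nonneg_left (ContinuousLinearMap.le_opNorm _ _) (norm_nonneg _)
      _ = ‖C.q ^ k‖ * (‖u‖ * ‖(Ce C e).U η a v‖) := by ring
  rw [ContinuousLinearMap.norm_map_of_mem_unitary ((Ce C e).U_mem_unitary η a)] at h
  exact h.trans (mul_le_of_le_one_left (by positivity) (B3VertexTensorBounds.norm_q_pow_le_one C k))

/-- the constant `K_k = Σ_bη^dc²|η|ᵏ`. [folklore] -/
def Kk (P : Params) (j : ℕ) (η w c : ℝ) (k : ℕ) : ℝ := ∑ _b : PBond P j, |w| * (c ^ 2 * |η| ^ k)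

omit C m2 μ2 in
/-- `K_k ≥ 0`. [folklore] -/
private theorem Kk_nonneg (k : ℕ) : 0 ≤ Kk P j η w c k := Finset.sum_nonneg fun _ _ => by positivity

/-- **`|h_k(e; A, φ)| ≤ K_k·aᵏ·sup|φ|²`** for `|A_b| ≤ a`, uniformly in `e`. [cite: Balaban1983Higgs3, (1.8), (1.10) p.413] -/
theorem abs_hopK_le (k : ℕ) (e : ℝ) (A : VecField P j ℝ) (φ : Cfg P j N) {a : ℝ} (hA : ∀ b, |A b| ≤ a) :
    |hopK C η w c k e A φ| ≤ Kk P j η w c k * (a ^ k * ‖φ‖ ^ 2) := by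
  unfold hopK Kk
  rw [Finset.sum_mul]
  refine (Finset.abs_sum_le_sum_abs _ _).trans (Finset.sum_le_sum fun b _ => ?_)
  have ha : 0 ≤ a := (abs_nonneg _).trans (hA b)
  rw [abs_mul, abs_mul, abs_mul, abs_of_nonneg (sq_nonneg c), abs_pow, abs_mul]
  have h1 := abs_inner_qpowU_le C η k e (A b) (φ b.src) (φ b.tgt)
  have h2 : ‖φ b.src‖ * ‖φ b.tgt‖ ≤ ‖φ‖ ^ 2 := by
    rw [sq]; exact mul_le_mul (norm_le_pi_norm φ _) (norm_le_pi_norm φ _) (norm_nonneg _) (norm_nonneg _)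
  have h3 : (|η| * |A b|) ^ k ≤ |η| ^ k * a ^ k := by
    rw [mul_pow]; exact mul_le_mul_of_nonneg_left (pow_le_pow_left₀ (abs_nonneg _) (hA b) k) (pow_nonneg (abs_nonneg _) k)
  calc |w| * (c ^ 2 * ((|η| * |A b|) ^ k * |⟪φ b.src, (C.q ^ k) ((Ce C e).U η (A b) (φ b.tgt))⟫_ℝ|))
      ≤ |w| * (c ^ 2 * (|η| ^ k * a ^ k * ‖φ‖ ^ 2)) :=
        mul_le_mul_of_nonneg_left (mul_le_mul_of_nonneg_left (mul_le_mul h3 (h1.trans h2) (abs_nonneg _)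
          (mul_nonneg (pow_nonneg (abs_nonneg η) k) (pow_nonneg ha k))) (sq_nonneg c)) (abs_nonneg w)
    _ = |w| * (c ^ 2 * |η| ^ k) * (a ^ k * ‖φ‖ ^ 2) := by ring

omit C η w c m2 μ2 in
/-- `t ≤ e^t`. [folklore] -/
private theorem le_exp_self (t : ℝ) : t ≤ Real.exp t := by linarith [Real.add_one_le_exp t]

omit C η w c m2 μ2 in
/-- `tⁱ ≤ e^{it}` for `t ≥ 0`. [folklore] -/
private theorem pow_le_exp_nat_mul {t : ℝ} (ht : 0 ≤ t) (i : ℕ) : t ^ i ≤ Real.exp (i * t) := by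
  calc t ^ i ≤ Real.exp t ^ i := pow_le_pow_left₀ ht (le_exp_self t) i
    _ = Real.exp (i * t) := by rw [← Real.exp_nat_mul]

/-- **every polynomial in the `h_i` is of exponential-linear growth in `(sup|A|, sup|φ|)`, uniformly in the charge**.
(v1.1, D-g100-1: (2.23)–(2.24) p. 430 are the Ward–Takahashi identities, where print's `F` is *"an arbitrary gauge-invariant function
of scalar fields"*, taken polynomial; the exponential-linear growth class `∣F∣ ≤ K_Fe^{κ_F sup∣φ∣}` is OURS — the admissibility class of
this file's dominated differentiation, not print's.) [cite: Balaban1983Higgs3, (2.23)–(2.24) p.430 (print's F: arbitrary gauge-invariant, polynomial; the growth class is ours)] -/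
theorem eval_bound (p : MvPolynomial ℕ ℝ) : ∃ K κ₁ κ₂ : ℝ, 0 ≤ K ∧ 0 ≤ κ₁ ∧ 0 ≤ κ₂ ∧
    ∀ (e : ℝ) (A : VecField P j ℝ) (φ : Cfg P j N) (a : ℝ), 0 ≤ a → (∀ b, |A b| ≤ a) →
      |MvPolynomial.eval (fun i : ℕ => hopK C η w c i e A φ) p| ≤ K * (Real.exp (κ₁ * a) * Real.exp (κ₂ * ‖φ‖)) := by
  induction p using MvPolynomial.induction_on with
  | C r =>
    refine ⟨|r|, 0, 0, abs_nonneg _, le_rfl, le_rfl, fun e A φ a _ _ => ?_⟩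
    simp only [eval_C, zero_mul, Real.exp_zero, mul_one, le_refl]
  | add p q hp hq =>
    obtain ⟨K₁, a₁, b₁, hK₁, ha₁, hb₁, h₁⟩ := hp
    obtain ⟨K₂, a₂, b₂, hK₂, ha₂, hb₂, h₂⟩ := hq
    refine ⟨K₁ + K₂, max a₁ a₂, max b₁ b₂, add_nonneg hK₁ hK₂, ha₁.trans (le_max_left _ _),
      hb₁.trans (le_max_left _ _), fun e A φ a ha hA => ?_⟩
    rw [map_add]
    have g₁ := h₁ e A φ a ha hA
    have g₂ := h₂ e A φ a ha hA
    have m₁ : Real.exp (a₁ * a) * Real.exp (b₁ * ‖φ‖) ≤ Real.exp (max a₁ a₂ * a) * Real.exp (max b₁ b₂ * ‖φ‖) :=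
      mul_le_mul (Real.exp_le_exp.mpr (mul_le_mul_of_nonneg_right (le_max_left _ _) ha))
        (Real.exp_le_exp.mpr (mul_le_mul_of_nonneg_right (le_max_left _ _) (norm_nonneg _)))
        (Real.exp_pos _).le (Real.exp_pos _).le
    have m₂ : Real.exp (a₂ * a) * Real.exp (b₂ * ‖φ‖) ≤ Real.exp (max a₁ a₂ * a) * Real.exp (max b₁ b₂ * ‖φ‖) :=
      mul_le_mul (Real.exp_le_exp.mpr (mul_le_mul_of_nonneg_right (le_max_right _ _) ha))
        (Real.exp_le_exp.mpr (mul_le_mul_of_nonneg_right (le_max_right _ _) (norm_nonneg _)))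
        (Real.exp_pos _).le (Real.exp_pos _).le
    calc |MvPolynomial.eval (fun i : ℕ => hopK C η w c i e A φ) p + MvPolynomial.eval (fun i : ℕ => hopK C η w c i e A φ) q|
        ≤ K₁ * (Real.exp (a₁ * a) * Real.exp (b₁ * ‖φ‖)) + K₂ * (Real.exp (a₂ * a) * Real.exp (b₂ * ‖φ‖)) :=
          (abs_add_le _ _).trans (add_le_add g₁ g₂)
      _ ≤ K₁ * (Real.exp (max a₁ a₂ * a) * Real.exp (max b₁ b₂ * ‖φ‖))
          + K₂ * (Real.exp (max a₁ a₂ * a) * Real.exp (max b₁ b₂ * ‖φ‖)) :=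
          add_le_add (mul_le_mul_of_nonneg_left m₁ hK₁) (mul_le_mul_of_nonneg_left m₂ hK₂)
      _ = (K₁ + K₂) * (Real.exp (max a₁ a₂ * a) * Real.exp (max b₁ b₂ * ‖φ‖)) := by ring
  | mul_X p i hp =>
    obtain ⟨K, κ₁, κ₂, hK, hκ₁, hκ₂, h⟩ := hp
    refine ⟨K * Kk P j η w c i, κ₁ + i, κ₂ + 2, mul_nonneg hK (Kk_nonneg η w c i), add_nonneg hκ₁ (Nat.cast_nonneg i),
      add_nonneg hκ₂ (by norm_num), fun e A φ a ha hA => ?_⟩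
    rw [map_mul, eval_X, abs_mul]
    have g := h e A φ a ha hA
    have hb := abs_hopK_le C η w c i e A φ hA
    have hai : a ^ i ≤ Real.exp (i * a) := pow_le_exp_nat_mul ha i
    have ht : ‖φ‖ ^ 2 ≤ Real.exp (2 * ‖φ‖) := by
      have := pow_le_exp_nat_mul (norm_nonneg φ) 2
      simpa using this
    have hKk := Kk_nonneg (P := P) (j := j) η w c i
    calc |MvPolynomial.eval (fun i : ℕ => hopK C η w c i e A φ) p| * |hopK C η w c i e A φ|
        ≤ (K * (Real.exp (κ₁ * a) * Real.exp (κ₂ * ‖φ‖))) * (Kk P j η w c i * (a ^ i * ‖φ‖ ^ 2)) :=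
          mul_le_mul g hb (abs_nonneg _) (by positivity)
      _ ≤ (K * (Real.exp (κ₁ * a) * Real.exp (κ₂ * ‖φ‖))) * (Kk P j η w c i * (Real.exp (i * a) * Real.exp (2 * ‖φ‖))) := by
          gcongr
      _ = K * Kk P j η w c i * (Real.exp ((κ₁ + i) * a) * Real.exp ((κ₂ + 2) * ‖φ‖)) := by
          rw [add_mul, add_mul, Real.exp_add, Real.exp_add]; ring

/-- **`|D_k(e; A, φ)| ≤ K·e^{κ₁sup|A|}·e^{κ₂sup|φ|}`** uniformly in `e` (the growth class is ours, see `eval_bound`; print's `F` of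
(2.23)–(2.24) is an arbitrary gauge-invariant polynomial). [cite: Balaban1983Higgs3, (2.23)–(2.24) p.430 (print's F: arbitrary gauge-invariant, polynomial; the growth class is ours)] -/
theorem abs_Dk_le (k : ℕ) : ∃ K κ₁ κ₂ : ℝ, 0 ≤ K ∧ 0 ≤ κ₁ ∧ 0 ≤ κ₂ ∧
    ∀ (e : ℝ) (A : VecField P j ℝ) (φ : Cfg P j N) (a : ℝ), 0 ≤ a → (∀ b, |A b| ≤ a) →
      |Dk C η w c k e A φ| ≤ K * (Real.exp (κ₁ * a) * Real.exp (κ₂ * ‖φ‖)) :=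
  eval_bound C η w c (Dpoly k)

/-! ## §7 DIFFERENTIATION UNDER `∫dA∫dφ` TO ALL ORDERS: `∂ᵏ_e∫J_eF = ∫D_kJ_eF`, and `e ↦ ∫J_eF` is `C^∞` -/

/-- the product majorant with an arbitrary growth rate in the vector field:
`[W_A(A)e^{κ_A sup|A|}]·[e^{κ sup|φ|}e^{−(m²η^d/2)Σ|φ|²}]` is integrable (BRICK 7 `integrable_majorant` had `κ_A = 2`).
[cite: Balaban1983Higgs3, (1.19) p.416] -/
theorem integrable_majorant' (hw : 0 < w) (hm : 0 < m2) (hμ : 0 < μ2) {κA : ℝ} (hκA : 0 ≤ κA) (κ : ℝ) :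
    Integrable (fun p : JCfg P j N => (WA η w c μ2 p.1 * Real.exp (κA * ‖p.1‖)) *
      (Real.exp (κ * ‖p.2‖) * Real.exp (-(m2 * w / 2) * ∑ x : Site P j, ‖p.2 x‖ ^ 2))) := by
  have hA : Integrable (fun A : Cfg P j P.d => WA η w c μ2 A * Real.exp (κA * ‖A‖)) :=
    ExpGrowth.integrable (Cvec P.d) η w c μ2 hw hμ
      ⟨(continuous_const.mul continuous_norm).rexp, 1, κA, zero_le_one, hκA,
        fun A => by rw [abs_of_pos (Real.exp_pos _), one_mul]⟩
  have hφ := B3WT224Instance.integrable_explin_mul_gauss (P := P) (j := j) (N := N) κ (half_pos (mul_pos hm hw))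
  have hφ' : Integrable (fun φ : Cfg P j N => Real.exp (κ * ‖φ‖) * Real.exp (-(m2 * w / 2) * ∑ x : Site P j, ‖φ x‖ ^ 2)) := by
    refine hφ.congr (Filter.Eventually.of_forall fun φ => ?_)
    show Real.exp (κ * ‖φ‖) * Real.exp (-(m2 * w / 2) * ∑ x : Site P j, ‖φ x‖ ^ 2) =
      Real.exp (κ * ‖φ‖) * Real.exp (-(m2 * w / 2) * ∑ x : Site P j, ‖φ x‖ ^ 2)
    rfl
  have h := hA.mul_prod hφ'
  rw [← Measure.volume_eq_prod] at h
  exact h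

/-- the pointwise domination `|D_k·J_e·F| ≤ (K_DK_F)·majorant`, uniform in `e`. [cite: Balaban1983Higgs3, (1.19) p.416] -/
private theorem norm_Dk_J_F_le (hw : 0 < w) {k : ℕ} {KD κ₁ κ₂ K κ : ℝ} (hKD : 0 ≤ KD)
    (hD : ∀ (e : ℝ) (A : VecField P j ℝ) (φ : Cfg P j N) (a : ℝ), 0 ≤ a → (∀ b, |A b| ≤ a) →
      |Dk C η w c k e A φ| ≤ KD * (Real.exp (κ₁ * a) * Real.exp (κ₂ * ‖φ‖)))
    {F : Cfg P j N → ℝ} (hFb : ∀ φ, |F φ| ≤ K * Real.exp (κ * ‖φ‖)) (e : ℝ) (p : JCfg P j N) :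
    ‖Dk C η w c k e (toVec p.1) p.2 * J C η w c m2 μ2 e p * F p.2‖ ≤ KD * K * ((WA η w c μ2 p.1 * Real.exp (κ₁ * ‖p.1‖)) *
      (Real.exp ((κ₂ + κ) * ‖p.2‖) * Real.exp (-(m2 * w / 2) * ∑ x : Site P j, ‖p.2 x‖ ^ 2))) := by
  rw [Real.norm_eq_abs, abs_mul, abs_mul, J, abs_mul, abs_of_pos (WA_pos η w c μ2 p.1), abs_of_pos (weight_pos _ _)]
  have hWA : 0 ≤ WA η w c μ2 p.1 := (WA_pos η w c μ2 p.1).le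
  have hD' := hD e (toVec p.1) p.2 ‖p.1‖ (norm_nonneg _) (abs_toVec_le p.1)
  have h1 : weight (Ce C e) η w c m2 (toVec p.1) p.2 ≤ Real.exp (-(m2 * w / 2) * ∑ x : Site P j, ‖p.2 x‖ ^ 2) :=
    weight_Ce_le C η w c m2 hw.le e _ _
  have hX1 : 0 ≤ WA η w c μ2 p.1 * weight (Ce C e) η w c m2 (toVec p.1) p.2 := mul_nonneg hWA (weight_pos _ _).le
  have hX2 : 0 ≤ KD * (Real.exp (κ₁ * ‖p.1‖) * Real.exp (κ₂ * ‖p.2‖)) := by positivity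
  have hX3 : 0 ≤ KD * (Real.exp (κ₁ * ‖p.1‖) * Real.exp (κ₂ * ‖p.2‖)) *
      (WA η w c μ2 p.1 * Real.exp (-(m2 * w / 2) * ∑ x : Site P j, ‖p.2 x‖ ^ 2)) :=
    mul_nonneg hX2 (mul_nonneg hWA (Real.exp_pos _).le)
  calc |Dk C η w c k e (toVec p.1) p.2| * (WA η w c μ2 p.1 * weight (Ce C e) η w c m2 (toVec p.1) p.2) * |F p.2|
      ≤ (KD * (Real.exp (κ₁ * ‖p.1‖) * Real.exp (κ₂ * ‖p.2‖))) *
          (WA η w c μ2 p.1 * Real.exp (-(m2 * w / 2) * ∑ x : Site P j, ‖p.2 x‖ ^ 2)) * (K * Real.exp (κ * ‖p.2‖)) :=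
        mul_le_mul (mul_le_mul hD' (mul_le_mul_of_nonneg_left h1 hWA) hX1 hX2) (hFb p.2) (abs_nonneg _) hX3
    _ = KD * K * ((WA η w c μ2 p.1 * Real.exp (κ₁ * ‖p.1‖)) *
          ((Real.exp (κ₂ * ‖p.2‖) * Real.exp (κ * ‖p.2‖)) * Real.exp (-(m2 * w / 2) * ∑ x : Site P j, ‖p.2 x‖ ^ 2))) := by
        ring
    _ = KD * K * ((WA η w c μ2 p.1 * Real.exp (κ₁ * ‖p.1‖)) *
          (Real.exp ((κ₂ + κ) * ‖p.2‖) * Real.exp (-(m2 * w / 2) * ∑ x : Site P j, ‖p.2 x‖ ^ 2))) := by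
        rw [add_mul, Real.exp_add]

/-- **integrability of `D_k(e)·e^{−S_e}·F`** for every `k`, `e` and every observable `F` of exponential-linear growth.
[cite: Balaban1983Higgs3, (1.19) p.416] -/
theorem integrable_Dk_J_mul (hw : 0 < w) (hm : 0 < m2) (hμ : 0 < μ2) {F : Cfg P j N → ℝ} (hF : ExpGrowth F)
    (k : ℕ) (e : ℝ) :
    Integrable (fun p : JCfg P j N => Dk C η w c k e (toVec p.1) p.2 * J C η w c m2 μ2 e p * F p.2) := by
  obtain ⟨hFc, K, κ, hK, hκ, hFb⟩ := id hF
  obtain ⟨KD, κ₁, κ₂, hKD, hκ₁, hκ₂, hD⟩ := abs_Dk_le C η w c (P := P) (j := j) k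
  exact ((integrable_majorant' (P := P) (j := j) (N := N) η w c m2 μ2 hw hm hμ hκ₁ (κ₂ + κ)).const_mul (KD * K)).mono'
    ((((continuous_Dk C η w c k e).mul (continuous_J C η w c m2 μ2 e)).mul (hFc.comp continuous_snd)).aestronglyMeasurable)
    (Filter.Eventually.of_forall fun p => norm_Dk_J_F_le C η w c m2 μ2 hw hKD hD hFb e p)

/-- **DIFFERENTIATION UNDER `∫dA∫dφ` IN THE CHARGE, EVERY ORDER**: `d/de ∫D_k(e)e^{−S_e}F = ∫D_{k+1}(e)e^{−S_e}F` at every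
`e₀` (dominated differentiation, the majorant of `D_{k+1}` being uniform in `e`; BRICK 7 = the cases `k = 0, 1`).
[cite: Balaban1983Higgs3, (1.19)–(1.21) p.416, (1.24) p.417] -/
theorem hasDerivAt_integral_Dk_J_mul (hw : 0 < w) (hm : 0 < m2) (hμ : 0 < μ2) {F : Cfg P j N → ℝ} (hF : ExpGrowth F)
    (k : ℕ) (e₀ : ℝ) :
    HasDerivAt (fun e => ∫ p : JCfg P j N, Dk C η w c k e (toVec p.1) p.2 * J C η w c m2 μ2 e p * F p.2)
      (∫ p : JCfg P j N, Dk C η w c (k + 1) e₀ (toVec p.1) p.2 * J C η w c m2 μ2 e₀ p * F p.2) e₀ := by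
  obtain ⟨hFc, K, κ, hK, hκ, hFb⟩ := id hF
  obtain ⟨KD, κ₁, κ₂, hKD, hκ₁, hκ₂, hD⟩ := abs_Dk_le C η w c (P := P) (j := j) (k + 1)
  have hbound := (integrable_majorant' (P := P) (j := j) (N := N) η w c m2 μ2 hw hm hμ hκ₁ (κ₂ + κ)).const_mul (KD * K)
  refine (hasDerivAt_integral_of_dominated_loc_of_deriv_le
    (F := fun e p => Dk C η w c k e (toVec p.1) p.2 * J C η w c m2 μ2 e p * F p.2)
    (F' := fun e p => Dk C η w c (k + 1) e (toVec p.1) p.2 * J C η w c m2 μ2 e p * F p.2) Filter.univ_mem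
    (Filter.Eventually.of_forall fun e => (((continuous_Dk C η w c k e).mul (continuous_J C η w c m2 μ2 e)).mul
      (hFc.comp continuous_snd)).aestronglyMeasurable)
    (integrable_Dk_J_mul C η w c m2 μ2 hw hm hμ hF k e₀)
    ((((continuous_Dk C η w c (k + 1) e₀).mul (continuous_J C η w c m2 μ2 e₀)).mul
      (hFc.comp continuous_snd)).aestronglyMeasurable)
    (Filter.Eventually.of_forall fun p e _ => norm_Dk_J_F_le C η w c m2 μ2 hw hKD hD hFb e p) hbound
    (Filter.Eventually.of_forall fun p e _ => ?_)).2
  have h := ((hasDerivAt_Dk_mul_weight C η w c m2 k (toVec p.1) p.2 e).const_mul (WA η w c μ2 p.1)).mul_const (F p.2)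
  have hfun : (fun x : ℝ => Dk C η w c k x (toVec p.1) p.2 * (WA η w c μ2 p.1 * weight (Ce C x) η w c m2 (toVec p.1) p.2) *
      F p.2) = fun y => WA η w c μ2 p.1 * (Dk C η w c k y (toVec p.1) p.2 * weight (Ce C y) η w c m2 (toVec p.1) p.2) * F p.2 := by
    funext y; ring
  simp only [J]
  rw [hfun]
  refine h.congr_deriv ?_
  ring

/-- **`∂ᵏ/∂eᵏ ∫dA dφ e^{−S_e(A,φ)}F(φ) = ∫dA dφ D_k(e;A,φ)e^{−S_e}F(φ)`** for every `k` and every `e`: the charge derivatives of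
all orders of the un-normalized expectations of (1.19)/(1.24) are the expectations of the insertions `D_k`.
[cite: Balaban1983Higgs3, (1.19)–(1.21) p.416, (1.24) p.417] [cite: GlimmJaffeQP1987, §8.5] -/
theorem iteratedDeriv_integral_J_mul (hw : 0 < w) (hm : 0 < m2) (hμ : 0 < μ2) {F : Cfg P j N → ℝ} (hF : ExpGrowth F)
    (k : ℕ) (e : ℝ) :
    iteratedDeriv k (fun s : ℝ => ∫ p : JCfg P j N, J C η w c m2 μ2 s p * F p.2) e =
      ∫ p : JCfg P j N, Dk C η w c k e (toVec p.1) p.2 * J C η w c m2 μ2 e p * F p.2 := by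
  induction k generalizing e with
  | zero =>
    rw [iteratedDeriv_zero]
    exact integral_congr_ae (Filter.Eventually.of_forall fun p => by simp only [Dk_zero, one_mul])
  | succ k ih =>
    rw [iteratedDeriv_succ, show iteratedDeriv k (fun s : ℝ => ∫ p : JCfg P j N, J C η w c m2 μ2 s p * F p.2) =
      fun s => ∫ p : JCfg P j N, Dk C η w c k s (toVec p.1) p.2 * J C η w c m2 μ2 s p * F p.2 from funext ih]
    exact (hasDerivAt_integral_Dk_J_mul C η w c m2 μ2 hw hm hμ hF k e).deriv

/-- **`e ↦ ∫dA dφ e^{−S_e}F` IS `Cⁿ` FOR EVERY `n`** (all its iterated derivatives are differentiable).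
[cite: Balaban1983Higgs3, (1.19) p.416, (1.24) p.417] -/
theorem contDiff_integral_J_mul (hw : 0 < w) (hm : 0 < m2) (hμ : 0 < μ2) {F : Cfg P j N → ℝ} (hF : ExpGrowth F) (n : ℕ∞) :
    ContDiff ℝ n (fun s : ℝ => ∫ p : JCfg P j N, J C η w c m2 μ2 s p * F p.2) := by
  refine contDiff_of_differentiable_iteratedDeriv fun m _ => ?_
  rw [show iteratedDeriv m (fun s : ℝ => ∫ p : JCfg P j N, J C η w c m2 μ2 s p * F p.2) =
    fun s => ∫ p : JCfg P j N, Dk C η w c m s (toVec p.1) p.2 * J C η w c m2 μ2 s p * F p.2 from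
    funext (iteratedDeriv_integral_J_mul C η w c m2 μ2 hw hm hμ hF m)]
  exact fun e => (hasDerivAt_integral_Dk_J_mul C η w c m2 μ2 hw hm hμ hF m e).differentiableAt

/-- in particular the normalization `Z(e) = ∫dA dφ e^{−S_e}` (`F = 1`): `Z⁽ᵏ⁾(e) = ∫D_k(e)e^{−S_e}` for every `k`.
[cite: Balaban1983Higgs3, (1.19) p.416, (1.24) p.417] -/
theorem iteratedDeriv_Z (hw : 0 < w) (hm : 0 < m2) (hμ : 0 < μ2) (k : ℕ) (e : ℝ) :
    iteratedDeriv k (fun s : ℝ => ∫ p : JCfg P j N, J C η w c m2 μ2 s p) e =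
      ∫ p : JCfg P j N, Dk C η w c k e (toVec p.1) p.2 * J C η w c m2 μ2 e p := by
  have h := iteratedDeriv_integral_J_mul C η w c m2 μ2 hw hm hμ (ExpGrowth.const (P := P) (j := j) (N := N) 1) k e
  simp only [mul_one] at h
  exact h

/-! ## §8 ALONG THE MASS CURVE UNDER `∫dA dφ`: on an open set `S` of charges where `m² + ct(e) ≥ m²/2` and the
`ct_i` are bounded, `∂ᵏ_e∫J_e(m²+ct(e))F = ∫D^M_k·J_e(m²+ct(e))F` -/

namespace MassCurve

variable {cts : ℕ → ℝ → ℝ} {S : Set ℝ} {Bc : ℝ}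

omit C η c m2 μ2 in
/-- `Σ_xη^d∣φ(x)∣² ≤ ∣T∣·∣η^d∣·sup∣φ∣²`. [folklore] -/
private theorem massForm_le (φ : Cfg P j N) : |massForm w φ| ≤ (Fintype.card (Site P j) * |w|) * ‖φ‖ ^ 2 := by
  unfold massForm
  refine (Finset.abs_sum_le_sum_abs _ _).trans ?_
  have h : ∀ x ∈ (Finset.univ : Finset (Site P j)), |w * ‖φ x‖ ^ 2| ≤ |w| * ‖φ‖ ^ 2 := fun x _ => by
    rw [abs_mul, abs_of_nonneg (sq_nonneg ‖φ x‖)]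
    exact mul_le_mul_of_nonneg_left (pow_le_pow_left₀ (norm_nonneg _) (norm_le_pi_norm φ x) 2) (abs_nonneg _)
  refine (Finset.sum_le_sum h).trans ?_
  rw [Finset.sum_const, Finset.card_univ, nsmul_eq_mul]
  ring_nf
  rfl

/-- **`∣f_i(e;A,φ)∣ ≤ (K_iaⁱ + ½∣B_c∣∣T∣∣η^d∣)·sup∣φ∣²`** on `S` (`∣ct_i∣ ≤ B_c` on `S`), uniformly in `e ∈ S`.
[cite: Balaban1983Higgs3, (1.20) p.416, (1.23) p.417] -/
theorem abs_fM_le (hBc : ∀ (i : ℕ), ∀ e ∈ S, |cts i e| ≤ Bc) (i : ℕ) {e : ℝ} (he : e ∈ S) (A : VecField P j ℝ)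
    (φ : Cfg P j N) {a : ℝ} (hA : ∀ b, |A b| ≤ a) :
    |fM C η w c cts i e A φ| ≤ (Kk P j η w c i * a ^ i + 1 / 2 * |Bc| * (Fintype.card (Site P j) * |w|)) * ‖φ‖ ^ 2 := by
  unfold fM
  have h1 := abs_hopK_le C η w c i e A φ hA
  have h2 : |1 / 2 * cts i e * massForm w φ| ≤ 1 / 2 * |Bc| * (Fintype.card (Site P j) * |w|) * ‖φ‖ ^ 2 := by
    rw [abs_mul, abs_mul, abs_of_pos (by norm_num : (0 : ℝ) < 1 / 2)]
    calc 1 / 2 * |cts i e| * |massForm w φ| ≤ 1 / 2 * |Bc| * ((Fintype.card (Site P j) * |w|) * ‖φ‖ ^ 2) :=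
          mul_le_mul (mul_le_mul_of_nonneg_left ((hBc i e he).trans (le_abs_self _)) (by norm_num)) (massForm_le w φ)
            (abs_nonneg _) (by positivity)
      _ = 1 / 2 * |Bc| * (Fintype.card (Site P j) * |w|) * ‖φ‖ ^ 2 := by ring
  calc |hopK C η w c i e A φ - 1 / 2 * cts i e * massForm w φ|
      ≤ |hopK C η w c i e A φ| + |1 / 2 * cts i e * massForm w φ| := abs_sub _ _
    _ ≤ Kk P j η w c i * (a ^ i * ‖φ‖ ^ 2) + 1 / 2 * |Bc| * (Fintype.card (Site P j) * |w|) * ‖φ‖ ^ 2 := add_le_add h1 h2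
    _ = (Kk P j η w c i * a ^ i + 1 / 2 * |Bc| * (Fintype.card (Site P j) * |w|)) * ‖φ‖ ^ 2 := by ring

/-- every polynomial in the `f_i` is of exponential-linear growth in `(sup∣A∣, sup∣φ∣)`, uniformly in `e ∈ S` (the growth class is
ours, see `eval_bound`; print's `F` of (2.23)–(2.24) is an arbitrary gauge-invariant polynomial).
[cite: Balaban1983Higgs3, (2.23)–(2.24) p.430 (print's F: arbitrary gauge-invariant, polynomial; the growth class is ours)] -/
theorem evalM_bound (hBc : ∀ (i : ℕ), ∀ e ∈ S, |cts i e| ≤ Bc) (p : MvPolynomial ℕ ℝ) : ∃ K κ₁ κ₂ : ℝ, 0 ≤ K ∧ 0 ≤ κ₁ ∧ 0 ≤ κ₂ ∧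
    ∀ e ∈ S, ∀ (A : VecField P j ℝ) (φ : Cfg P j N) (a : ℝ), 0 ≤ a → (∀ b, |A b| ≤ a) →
      |MvPolynomial.eval (fun i : ℕ => fM C η w c cts i e A φ) p| ≤ K * (Real.exp (κ₁ * a) * Real.exp (κ₂ * ‖φ‖)) := by
  induction p using MvPolynomial.induction_on with
  | C r =>
    refine ⟨|r|, 0, 0, abs_nonneg _, le_rfl, le_rfl, fun e _ A φ a _ _ => ?_⟩
    simp only [eval_C, zero_mul, Real.exp_zero, mul_one, le_refl]
  | add p q hp hq =>
    obtain ⟨K₁, a₁, b₁, hK₁, ha₁, hb₁, h₁⟩ := hp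
    obtain ⟨K₂, a₂, b₂, hK₂, ha₂, hb₂, h₂⟩ := hq
    refine ⟨K₁ + K₂, max a₁ a₂, max b₁ b₂, add_nonneg hK₁ hK₂, ha₁.trans (le_max_left _ _),
      hb₁.trans (le_max_left _ _), fun e he A φ a ha hA => ?_⟩
    rw [map_add]
    have g₁ := h₁ e he A φ a ha hA
    have g₂ := h₂ e he A φ a ha hA
    have m₁ : Real.exp (a₁ * a) * Real.exp (b₁ * ‖φ‖) ≤ Real.exp (max a₁ a₂ * a) * Real.exp (max b₁ b₂ * ‖φ‖) :=
      mul_le_mul (Real.exp_le_exp.mpr (mul_le_mul_of_nonneg_right (le_max_left _ _) ha))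
        (Real.exp_le_exp.mpr (mul_le_mul_of_nonneg_right (le_max_left _ _) (norm_nonneg _)))
        (Real.exp_pos _).le (Real.exp_pos _).le
    have m₂ : Real.exp (a₂ * a) * Real.exp (b₂ * ‖φ‖) ≤ Real.exp (max a₁ a₂ * a) * Real.exp (max b₁ b₂ * ‖φ‖) :=
      mul_le_mul (Real.exp_le_exp.mpr (mul_le_mul_of_nonneg_right (le_max_right _ _) ha))
        (Real.exp_le_exp.mpr (mul_le_mul_of_nonneg_right (le_max_right _ _) (norm_nonneg _)))
        (Real.exp_pos _).le (Real.exp_pos _).le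
    calc |MvPolynomial.eval (fun i : ℕ => fM C η w c cts i e A φ) p + MvPolynomial.eval (fun i : ℕ => fM C η w c cts i e A φ) q|
        ≤ K₁ * (Real.exp (a₁ * a) * Real.exp (b₁ * ‖φ‖)) + K₂ * (Real.exp (a₂ * a) * Real.exp (b₂ * ‖φ‖)) :=
          (abs_add_le _ _).trans (add_le_add g₁ g₂)
      _ ≤ K₁ * (Real.exp (max a₁ a₂ * a) * Real.exp (max b₁ b₂ * ‖φ‖))
          + K₂ * (Real.exp (max a₁ a₂ * a) * Real.exp (max b₁ b₂ * ‖φ‖)) :=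
          add_le_add (mul_le_mul_of_nonneg_left m₁ hK₁) (mul_le_mul_of_nonneg_left m₂ hK₂)
      _ = (K₁ + K₂) * (Real.exp (max a₁ a₂ * a) * Real.exp (max b₁ b₂ * ‖φ‖)) := by ring
  | mul_X p i hp =>
    obtain ⟨K, κ₁, κ₂, hK, hκ₁, hκ₂, h⟩ := hp
    set c0 : ℝ := 1 / 2 * |Bc| * (Fintype.card (Site P j) * |w|) with hc0
    have hc0n : 0 ≤ c0 := by positivity
    refine ⟨K * (Kk P j η w c i + c0), κ₁ + i, κ₂ + 2, mul_nonneg hK (add_nonneg (Kk_nonneg η w c i) hc0n),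
      add_nonneg hκ₁ (Nat.cast_nonneg i), add_nonneg hκ₂ (by norm_num), fun e he A φ a ha hA => ?_⟩
    rw [map_mul, eval_X, abs_mul]
    have g := h e he A φ a ha hA
    have hb := abs_fM_le C η w c hBc i he A φ hA
    have hai : a ^ i ≤ Real.exp (i * a) := pow_le_exp_nat_mul ha i
    have hai1 : (1 : ℝ) ≤ Real.exp (i * a) := Real.one_le_exp (by positivity)
    have ht : ‖φ‖ ^ 2 ≤ Real.exp (2 * ‖φ‖) := by
      have := pow_le_exp_nat_mul (norm_nonneg φ) 2
      simpa using this
    have hKk := Kk_nonneg (P := P) (j := j) η w c i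
    have hcoef : Kk P j η w c i * a ^ i + c0 ≤ (Kk P j η w c i + c0) * Real.exp (i * a) := by
      rw [add_mul]
      exact add_le_add (mul_le_mul_of_nonneg_left hai hKk) (le_mul_of_one_le_right hc0n hai1)
    have hnn : 0 ≤ Kk P j η w c i * a ^ i + c0 := add_nonneg (mul_nonneg hKk (pow_nonneg ha i)) hc0n
    calc |MvPolynomial.eval (fun i : ℕ => fM C η w c cts i e A φ) p| * |fM C η w c cts i e A φ|
        ≤ (K * (Real.exp (κ₁ * a) * Real.exp (κ₂ * ‖φ‖))) * ((Kk P j η w c i * a ^ i + c0) * ‖φ‖ ^ 2) :=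
          mul_le_mul g hb (abs_nonneg _) (by positivity)
      _ ≤ (K * (Real.exp (κ₁ * a) * Real.exp (κ₂ * ‖φ‖))) * (((Kk P j η w c i + c0) * Real.exp (i * a)) * Real.exp (2 * ‖φ‖)) :=
          mul_le_mul_of_nonneg_left (mul_le_mul hcoef ht (sq_nonneg _) (by positivity)) (by positivity)
      _ = K * (Kk P j η w c i + c0) * (Real.exp ((κ₁ + i) * a) * Real.exp ((κ₂ + 2) * ‖φ‖)) := by
          rw [show (κ₁ + i) * a = κ₁ * a + i * a by ring, show (κ₂ + 2) * ‖φ‖ = κ₂ * ‖φ‖ + 2 * ‖φ‖ by ring,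
            Real.exp_add, Real.exp_add]
          ring

/-- **`∣D^M_k(e;A,φ)∣ ≤ K·e^{κ₁sup∣A∣}·e^{κ₂sup∣φ∣}`** uniformly in `e ∈ S` (the growth class is ours, see `eval_bound`; print's `F`
of (2.23)–(2.24) is an arbitrary gauge-invariant polynomial). [cite: Balaban1983Higgs3, (2.23)–(2.24) p.430 (print's F: arbitrary gauge-invariant, polynomial; the growth class is ours)] -/
theorem abs_DkM_le (hBc : ∀ (i : ℕ), ∀ e ∈ S, |cts i e| ≤ Bc) (k : ℕ) : ∃ K κ₁ κ₂ : ℝ, 0 ≤ K ∧ 0 ≤ κ₁ ∧ 0 ≤ κ₂ ∧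
    ∀ e ∈ S, ∀ (A : VecField P j ℝ) (φ : Cfg P j N) (a : ℝ), 0 ≤ a → (∀ b, |A b| ≤ a) →
      |DkM C η w c cts k e A φ| ≤ K * (Real.exp (κ₁ * a) * Real.exp (κ₂ * ‖φ‖)) :=
  evalM_bound C η w c hBc (Dpoly k)

/-- continuity of `(A, φ) ↦ D^M_k(e; A, φ)`. [folklore] -/
private theorem continuous_DkM (k : ℕ) (e : ℝ) : Continuous fun p : JCfg P j N => DkM C η w c cts k e (toVec p.1) p.2 := by
  unfold DkM
  refine (MvPolynomial.continuous_eval (p := Dpoly k)).comp (continuous_pi fun i => ?_)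
  unfold fM
  refine (continuous_hopK C η w c i e).sub (continuous_const.mul ?_)
  unfold massForm
  exact continuous_finsetSum _ fun x _ => continuous_const.mul (((continuous_apply x).comp continuous_snd).norm.pow 2)

/-- the weight along the curve is dominated by the free Gaussian of HALF the mass where `m² + ct(e) ≥ m²/2`.
[cite: Balaban1983Higgs3, (1.20) p.416, (1.23) p.417] -/
theorem weight_massCurve_le (hw : 0 ≤ w) {e : ℝ} (hm : m2 / 2 ≤ m2 + cts 0 e) (A : VecField P j ℝ) (φ : Cfg P j N) :
    weight (Ce C e) η w c (m2 + cts 0 e) A φ ≤ Real.exp (-(m2 / 2 * w / 2) * ∑ x : Site P j, ‖φ x‖ ^ 2) := by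
  refine (weight_Ce_le C η w c (m2 + cts 0 e) hw e A φ).trans (Real.exp_le_exp.mpr ?_)
  have hS : 0 ≤ ∑ x : Site P j, ‖φ x‖ ^ 2 := Finset.sum_nonneg fun _ _ => sq_nonneg _
  nlinarith [mul_nonneg hw hS]

/-- the domination along the curve: `∣D^M_k·J_e(m²+ct(e))·F∣ ≤ (K_DK_F)·majorant_{m²/2}` for `e ∈ S`.
[cite: Balaban1983Higgs3, (1.19) p.416] -/
private theorem norm_DkM_J_F_le (hw : 0 < w) (hmass : ∀ e ∈ S, m2 / 2 ≤ m2 + cts 0 e) {k : ℕ} {KD κ₁ κ₂ K κ : ℝ} (hKD : 0 ≤ KD)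
    (hD : ∀ e ∈ S, ∀ (A : VecField P j ℝ) (φ : Cfg P j N) (a : ℝ), 0 ≤ a → (∀ b, |A b| ≤ a) →
      |DkM C η w c cts k e A φ| ≤ KD * (Real.exp (κ₁ * a) * Real.exp (κ₂ * ‖φ‖)))
    {F : Cfg P j N → ℝ} (hFb : ∀ φ, |F φ| ≤ K * Real.exp (κ * ‖φ‖)) {e : ℝ} (he : e ∈ S) (p : JCfg P j N) :
    ‖DkM C η w c cts k e (toVec p.1) p.2 * J C η w c (m2 + cts 0 e) μ2 e p * F p.2‖ ≤ KD * K *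
      ((WA η w c μ2 p.1 * Real.exp (κ₁ * ‖p.1‖)) *
        (Real.exp ((κ₂ + κ) * ‖p.2‖) * Real.exp (-(m2 / 2 * w / 2) * ∑ x : Site P j, ‖p.2 x‖ ^ 2))) := by
  rw [Real.norm_eq_abs, abs_mul, abs_mul, J, abs_mul, abs_of_pos (WA_pos η w c μ2 p.1), abs_of_pos (weight_pos _ _)]
  have hWA : 0 ≤ WA η w c μ2 p.1 := (WA_pos η w c μ2 p.1).le
  have hD' := hD e he (toVec p.1) p.2 ‖p.1‖ (norm_nonneg _) (abs_toVec_le p.1)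
  have h1 := weight_massCurve_le C η w c m2 hw.le (hmass e he) (toVec p.1) p.2
  have hX1 : 0 ≤ WA η w c μ2 p.1 * weight (Ce C e) η w c (m2 + cts 0 e) (toVec p.1) p.2 := mul_nonneg hWA (weight_pos _ _).le
  have hX2 : 0 ≤ KD * (Real.exp (κ₁ * ‖p.1‖) * Real.exp (κ₂ * ‖p.2‖)) := by positivity
  have hX3 : 0 ≤ KD * (Real.exp (κ₁ * ‖p.1‖) * Real.exp (κ₂ * ‖p.2‖)) *
      (WA η w c μ2 p.1 * Real.exp (-(m2 / 2 * w / 2) * ∑ x : Site P j, ‖p.2 x‖ ^ 2)) :=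
    mul_nonneg hX2 (mul_nonneg hWA (Real.exp_pos _).le)
  calc |DkM C η w c cts k e (toVec p.1) p.2| * (WA η w c μ2 p.1 * weight (Ce C e) η w c (m2 + cts 0 e) (toVec p.1) p.2) * |F p.2|
      ≤ (KD * (Real.exp (κ₁ * ‖p.1‖) * Real.exp (κ₂ * ‖p.2‖))) *
          (WA η w c μ2 p.1 * Real.exp (-(m2 / 2 * w / 2) * ∑ x : Site P j, ‖p.2 x‖ ^ 2)) * (K * Real.exp (κ * ‖p.2‖)) :=
        mul_le_mul (mul_le_mul hD' (mul_le_mul_of_nonneg_left h1 hWA) hX1 hX2) (hFb p.2) (abs_nonneg _) hX3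
    _ = KD * K * ((WA η w c μ2 p.1 * Real.exp (κ₁ * ‖p.1‖)) *
          ((Real.exp (κ₂ * ‖p.2‖) * Real.exp (κ * ‖p.2‖)) * Real.exp (-(m2 / 2 * w / 2) * ∑ x : Site P j, ‖p.2 x‖ ^ 2))) := by
        ring
    _ = KD * K * ((WA η w c μ2 p.1 * Real.exp (κ₁ * ‖p.1‖)) *
          (Real.exp ((κ₂ + κ) * ‖p.2‖) * Real.exp (-(m2 / 2 * w / 2) * ∑ x : Site P j, ‖p.2 x‖ ^ 2))) := by
        rw [add_mul, Real.exp_add]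

/-- **integrability of `D^M_k(e)·e^{−S_e}·F` along the curve** for `e ∈ S`. [cite: Balaban1983Higgs3, (1.19) p.416] -/
theorem integrable_DkM_J_mul (hw : 0 < w) (hm : 0 < m2) (hμ : 0 < μ2) (hBc : ∀ (i : ℕ), ∀ e ∈ S, |cts i e| ≤ Bc)
    (hmass : ∀ e ∈ S, m2 / 2 ≤ m2 + cts 0 e) {F : Cfg P j N → ℝ} (hF : ExpGrowth F) (k : ℕ) {e : ℝ} (he : e ∈ S) :
    Integrable (fun p : JCfg P j N => DkM C η w c cts k e (toVec p.1) p.2 * J C η w c (m2 + cts 0 e) μ2 e p * F p.2) := by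
  obtain ⟨hFc, K, κ, hK, hκ, hFb⟩ := id hF
  obtain ⟨KD, κ₁, κ₂, hKD, hκ₁, hκ₂, hD⟩ := abs_DkM_le C η w c (P := P) (j := j) hBc k
  exact ((integrable_majorant' (P := P) (j := j) (N := N) η w c (m2 / 2) μ2 hw (half_pos hm) hμ hκ₁ (κ₂ + κ)).const_mul
    (KD * K)).mono'
    ((((continuous_DkM C η w c k e).mul (continuous_J C η w c (m2 + cts 0 e) μ2 e)).mul
      (hFc.comp continuous_snd)).aestronglyMeasurable)
    (Filter.Eventually.of_forall fun p => norm_DkM_J_F_le C η w c m2 μ2 hw hmass hKD hD hFb he p)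

/-- **DIFFERENTIATION UNDER `∫dA∫dφ` ALONG THE MASS CURVE, EVERY ORDER**: for `S` open with `m² + ct ≥ m²/2` and bounded `ct_i` on
`S`, `d/de ∫D^M_k(e)·J_e(m²+ct(e))·F = ∫D^M_{k+1}(e)·J_e(m²+ct(e))·F` at every `e₀ ∈ S` (BRICKS 14/16/17 = low orders).
[cite: Balaban1983Higgs3, (1.19)–(1.21) p.416, (1.23)–(1.24) p.417] -/
theorem hasDerivAt_integral_DkM_J_mul (hw : 0 < w) (hm : 0 < m2) (hμ : 0 < μ2)
    (hct : ∀ (i : ℕ) (e : ℝ), HasDerivAt (cts i) (cts (i + 1) e) e) (hS : IsOpen S)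
    (hBc : ∀ (i : ℕ), ∀ e ∈ S, |cts i e| ≤ Bc) (hmass : ∀ e ∈ S, m2 / 2 ≤ m2 + cts 0 e)
    {F : Cfg P j N → ℝ} (hF : ExpGrowth F) (k : ℕ) {e₀ : ℝ} (he₀ : e₀ ∈ S) :
    HasDerivAt (fun e => ∫ p : JCfg P j N, DkM C η w c cts k e (toVec p.1) p.2 * J C η w c (m2 + cts 0 e) μ2 e p * F p.2)
      (∫ p : JCfg P j N, DkM C η w c cts (k + 1) e₀ (toVec p.1) p.2 * J C η w c (m2 + cts 0 e₀) μ2 e₀ p * F p.2) e₀ := by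
  obtain ⟨hFc, K, κ, hK, hκ, hFb⟩ := id hF
  obtain ⟨KD, κ₁, κ₂, hKD, hκ₁, hκ₂, hD⟩ := abs_DkM_le C η w c (P := P) (j := j) hBc (k + 1)
  have hbound := (integrable_majorant' (P := P) (j := j) (N := N) η w c (m2 / 2) μ2 hw (half_pos hm) hμ hκ₁ (κ₂ + κ)).const_mul
    (KD * K)
  refine (hasDerivAt_integral_of_dominated_loc_of_deriv_le
    (F := fun e p => DkM C η w c cts k e (toVec p.1) p.2 * J C η w c (m2 + cts 0 e) μ2 e p * F p.2)
    (F' := fun e p => DkM C η w c cts (k + 1) e (toVec p.1) p.2 * J C η w c (m2 + cts 0 e) μ2 e p * F p.2) (hS.mem_nhds he₀)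
    (Filter.Eventually.of_forall fun e => (((continuous_DkM C η w c k e).mul (continuous_J C η w c (m2 + cts 0 e) μ2 e)).mul
      (hFc.comp continuous_snd)).aestronglyMeasurable)
    (integrable_DkM_J_mul C η w c m2 μ2 hw hm hμ hBc hmass hF k he₀)
    ((((continuous_DkM C η w c (k + 1) e₀).mul (continuous_J C η w c (m2 + cts 0 e₀) μ2 e₀)).mul
      (hFc.comp continuous_snd)).aestronglyMeasurable)
    (Filter.Eventually.of_forall fun p e he => norm_DkM_J_F_le C η w c m2 μ2 hw hmass hKD hD hFb he p) hbound
    (Filter.Eventually.of_forall fun p e _ => ?_)).2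
  have h := ((hasDerivAt_DkM_mul_weight C η w c m2 hct k (toVec p.1) p.2 e).const_mul (WA η w c μ2 p.1)).mul_const (F p.2)
  have hfun : (fun x : ℝ => DkM C η w c cts k x (toVec p.1) p.2 *
      (WA η w c μ2 p.1 * weight (Ce C x) η w c (m2 + cts 0 x) (toVec p.1) p.2) * F p.2) =
      fun y => WA η w c μ2 p.1 * (DkM C η w c cts k y (toVec p.1) p.2 * weight (Ce C y) η w c (m2 + cts 0 y) (toVec p.1) p.2) *
        F p.2 := by
    funext y; ring
  simp only [J]
  rw [hfun]
  refine h.congr_deriv ?_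
  ring

/-- **`∂ᵏ/∂eᵏ ∫dA dφ e^{−S_e(m²+ct(e))}F = ∫dA dφ D^M_k(e)·e^{−S_e(m²+ct(e))}F` on `S`**, every `k` — the charge derivatives of
`Z^{ct}(e,0)` of (1.24) (print's counterterm curve `ct(e) = δm²_{(2,0)}e² + δm²_{(4,0)}e⁴`, `S` a ball at `0`) to all orders.
[cite: Balaban1983Higgs3, (1.23)–(1.24) p.417] [cite: GlimmJaffeQP1987, §8.5] -/
theorem iteratedDeriv_integral_J_massCurve (hw : 0 < w) (hm : 0 < m2) (hμ : 0 < μ2)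
    (hct : ∀ (i : ℕ) (e : ℝ), HasDerivAt (cts i) (cts (i + 1) e) e) (hS : IsOpen S)
    (hBc : ∀ (i : ℕ), ∀ e ∈ S, |cts i e| ≤ Bc) (hmass : ∀ e ∈ S, m2 / 2 ≤ m2 + cts 0 e)
    {F : Cfg P j N → ℝ} (hF : ExpGrowth F) (k : ℕ) {e : ℝ} (he : e ∈ S) :
    iteratedDeriv k (fun s : ℝ => ∫ p : JCfg P j N, J C η w c (m2 + cts 0 s) μ2 s p * F p.2) e =
      ∫ p : JCfg P j N, DkM C η w c cts k e (toVec p.1) p.2 * J C η w c (m2 + cts 0 e) μ2 e p * F p.2 := by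
  induction k generalizing e with
  | zero =>
    rw [iteratedDeriv_zero]
    exact integral_congr_ae (Filter.Eventually.of_forall fun p => by simp [DkM])
  | succ k ih =>
    rw [iteratedDeriv_succ]
    have hev : iteratedDeriv k (fun s : ℝ => ∫ p : JCfg P j N, J C η w c (m2 + cts 0 s) μ2 s p * F p.2) =ᶠ[nhds e]
        fun s => ∫ p : JCfg P j N, DkM C η w c cts k s (toVec p.1) p.2 * J C η w c (m2 + cts 0 s) μ2 s p * F p.2 :=
      Filter.eventually_of_mem (hS.mem_nhds he) fun s hs => ih hs
    rw [hev.deriv_eq]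
    exact (hasDerivAt_integral_DkM_J_mul C η w c m2 μ2 hw hm hμ hct hS hBc hmass hF k he).deriv

end MassCurve

end Literature.MathematicalPhysics.QuantumFieldTheory.Balaban1983to89.B3ChargeInsertionsHigher

end
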